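import Summits.QuantumAdvantage.AdviceFreeQNC0.AffBells37Sparse
import Summits.QuantumAdvantage.AdviceFreeQNC0.AffBells26MoveSystems
import HarnessLib

/-!
# AffBells37 (3/6) — the ALL-FIRSTS PAIR SLICING of the walk cube and the explicit character family of a slice

Cell qa-qnc0, route DWalkThree (crux stmt-QuantumAdvantage-22907; rung (NP₁) `AffBells26.AffBellsPolyLoss3`).  AUTHORED AND PROVED BY THE PLANNER qa-qnc0-p2 gen 34 (memo `HOME/qa-qnc0-p2/ROUND-34P2.md`, INBOX P2-34a/b, 2026-08-29); landed verbatim by qn-prover-3.  Part 3/6 of the all-firsts PAIR-SLICING + `𝔽₄`-KRAFT proof of (NP₁); the six parts are a mechanical split (≤ 400 lines each) of one kernel-checked file `AffBells37.lean` (rc 0, 0 sorries, axioms propext/Classical.choice/Quot.sound).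

Free `u`-positions `p_j = 3j+2`, `j < Fn := ⌊(n−1)/3⌋`; the slice through `a ∈ {0,1}^n` is `{U a v = a ⊕ w(v) : v ∈ {0,1}^{Fn}}` (`sum_sum_U`:
the slices cover the cube `2^{Fn}` times).  Flipping `u_{p_j}` flips exactly the input pair `x_{3j+2}, x_{3j+3}` (part 5 `xOfU_U`), so on a
slice every affine `𝔽₃` bell, every `tGuess` bit and every walk label is affine in `v`.  `S1` transports `affWinCard` to the walk cube
(`WalkTransport.rel_iff_ringWinU`).  Row data: `pathRow` (letters `σ·sg(a_{p_j})·λ_{jg}`), resonance values `rv`, test rows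
`testRow = m·rv + σ·path`, `Zcount` = their zero letters; the explicit family `rows/coefs : Ix n → …` (`|Ix n| = (n+1)(6+8Fn)`, `card_Ix`) and
its Kraft-mass bound `mass_rows_le` (`≤ 2(n+1)(1+8Fn) + Σ_{g,σ,m≠0} 2^{Zcount}`).  The two named statements of the line, both PROVED later:
`SliceExpansion` (part 5) and `ResonanceMGF` (part 4).  `growth1/2`: the numerical inequalities of the assembly (`Fn ≥ 30`).
-/

noncomputable section

namespace Summit.QuantumAdvantage.AdviceFreeQNC0.AffBells37

open Finset F4
open Classical

/-! ## Part II — the all-firsts pair slicing of the walk cube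

Free `u`-positions `p_j = 3j+2`, `j < Fn := ⌊(n−1)/3⌋`; the slice through `a` is `{U a v = a ⊕ w(v)}`.
Flipping `u_{p_j}` flips exactly `x_{3j+2}` and `x_{3j+3}` (`xOfU_U`), so on a slice every affine
`𝔽₃` bell, every `tGuess` bit and every walk label is affine in `v`. -/

section Slicing

open Literature.Computability.QuantumComplexity Literature.Computability.QuantumComplexity.RingHLF
open AffBells23 AffBells26

variable {F : ℕ} {ι : Type*} {n : ℕ}

/-- number of free pairs. -/
def Fn (n : ℕ) : ℕ := (n - 1) / 3

/-- `3·Fn n ≤ n − 1`: the free triples fit inside the ring. -/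
theorem three_Fn_le (n : ℕ) : 3 * Fn n ≤ n - 1 := by unfold Fn; omega

/-- free `u`-position `p_j = 3j + 2`. -/
def fpos (j : Fin (Fn n)) : Fin n := ⟨3 * j.val + 2, by have := j.isLt; unfold Fn at this; omega⟩

/-- the two `x`-positions moved by free bit `j`: `3j+2` and `3j+3` (indices of `Fin (n+1)`). -/
def xposA (j : Fin (Fn n)) : Fin (n + 1) := ⟨3 * j.val + 2, by have := j.isLt; unfold Fn at this; omega⟩
/-- the second `x`-position moved by free bit `j`: `3j+3` (index of `Fin (n+1)`). -/
def xposB (j : Fin (Fn n)) : Fin (n + 1) := ⟨3 * j.val + 3, by have := j.isLt; unfold Fn at this; omega⟩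

/-- the orbit positions (frozen neighbours deciding the resonance signs): `3j+1` and `3j+3` in `Fin n`. -/
def lpos (j : Fin (Fn n)) : Fin n := ⟨3 * j.val + 1, by have := j.isLt; unfold Fn at this; omega⟩
/-- the right orbit position `3j+3` in `Fin n`. -/
def rpos (j : Fin (Fn n)) : Fin n := ⟨3 * j.val + 3, by have := j.isLt; unfold Fn at this; omega⟩

/-- the free-bit translate `w(v)`: `v_j` at `p_j`, `false` elsewhere. -/
def wOf (v : Fin (Fn n) → Bool) (i : Fin n) : Bool :=
  if h : i.val % 3 = 2 ∧ i.val / 3 < Fn n then v ⟨i.val / 3, h.2⟩ else false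

/-- the slice point `U a v = a ⊕ w(v)`. -/
def U (a : Fin n → Bool) (v : Fin (Fn n) → Bool) : Fin n → Bool := fun i => xor (a i) (wOf v i)

/-- which free bit moves `x_i`: `V v i = v_j` if `i ∈ {3j+2, 3j+3}`, else `false`. -/
def V (v : Fin (Fn n) → Bool) (i : Fin (n + 1)) : Bool :=
  decide (∃ j : Fin (Fn n), v j = true ∧ (i = xposA j ∨ i = xposB j))

/-- The free-bit translate carries `v_j` at position `p_j`. -/
theorem wOf_fpos (v : Fin (Fn n) → Bool) (j : Fin (Fn n)) : wOf v (fpos j) = v j := by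
  unfold wOf fpos
  have h1 : (3 * j.val + 2) % 3 = 2 := by omega
  have h2 : (3 * j.val + 2) / 3 = j.val := by omega
  simp only [h1, h2, j.isLt, and_self, dif_pos]

/-- `U` is an involution in `a` for fixed `v`. -/
theorem U_U (a : Fin n → Bool) (v : Fin (Fn n) → Bool) : U (U a v) v = a := by
  funext i; unfold U; cases a i <;> cases wOf v i <;> rfl

/-- Re-randomisation: for fixed free bits, `a ↦ U a v` is a bijection of the cube. -/
theorem sum_U {M : Type*} [AddCommMonoid M] (f : (Fin n → Bool) → M) (v : Fin (Fn n) → Bool) :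
    ∑ a : Fin n → Bool, f (U a v) = ∑ a : Fin n → Bool, f a := by
  have hinv : Function.Involutive (fun a : Fin n → Bool => U a v) := fun a => U_U a v
  exact Equiv.sum_comp hinv.toPerm f

/-- Every point lies on `2^{Fn}` parametrised slices: `Σ_v Σ_a f(U a v) = 2^{Fn} Σ_u f u`. -/
theorem sum_sum_U (f : (Fin n → Bool) → ℕ) :
    ∑ v : Fin (Fn n) → Bool, ∑ a : Fin n → Bool, f (U a v) = 2 ^ Fn n * ∑ u : Fin n → Bool, f u := by
  simp_rw [sum_U f]
  rw [sum_const, card_univ, Fintype.card_fun, Fintype.card_bool, Fintype.card_fin, smul_eq_mul]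

/-! ### The transported affine-bells strategy and the transport inequality (S1) -/

/-- the walk strategy transported from the affine bells `(β, c)`: `y_g(u) = affBell(xOfU u)_g ⊕ t(xOfU u)_g`. -/
def yOf (β : Fin (n + 1) → Fin (n + 1) → ZMod 3) (c : Fin (n + 1) → ZMod 3) :
    Fin (n + 1) → (Fin n → Bool) → Bool :=
  fun g u => xor (affBell β c (xOfU u) g) (tGuess (xOfU u) g)

/-- WIN of the transported game at charge `n + 2`. -/
def Wn (β : Fin (n + 1) → Fin (n + 1) → ZMod 3) (c : Fin (n + 1) → ZMod 3) (u : Fin n → Bool) : Bool :=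
  ringWinU (n + 2) (yOf β c) u

/-- **(S1) transport**: `affWinCard β c ≤ #{u : WIN}` (the `hodd` block of `ringHard_two_of_walkHard`). -/
theorem S1 (hn : 2 ≤ n) (β : Fin (n + 1) → Fin (n + 1) → ZMod 3) (c : Fin (n + 1) → ZMod 3) :
    affWinCard β c ≤ (univ.filter fun u : Fin n → Bool => Wn β c u = true).card := by
  unfold affWinCard
  refine Finset.card_le_card_of_injOn uVec ?_ ?_
  · intro x hx
    rw [Finset.mem_coe, mem_filter] at hx
    rw [Finset.mem_coe, mem_filter]
    refine ⟨mem_univ _, ?_⟩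
    have hodd : (univ.filter fun j : Fin (n + 1) => x j = false).card % 2 = 1 := hx.2.1
    exact (rel_iff_ringWinU hn x hodd (affBell β c)).1 hx.2.2
  · intro x₁ hx₁ x₂ hx₂ h
    rw [Finset.mem_coe, mem_filter] at hx₁ hx₂
    have h1 : (univ.filter fun j : Fin (n + 1) => x₁ j = false).card % 2 = 1 := hx₁.2.1
    have h2 : (univ.filter fun j : Fin (n + 1) => x₂ j = false).card % 2 = 1 := hx₂.2.1
    rw [← xOfU_uVec hn x₁ h1, ← xOfU_uVec hn x₂ h2, h]

/-! ### Row data of a slice -/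

/-- sign `1 − 2[b] ∈ ℤ/3`. -/
def sg (b : Bool) : ZMod 3 := if b then -1 else 1

/-- `sg b ∈ {1, 2}` is nonzero. -/
theorem sg_ne_zero (b : Bool) : sg b ≠ 0 := by cases b <;> decide

/-- `σ`-multiple of the PATH ROW: letter `σ · sg(a_{p_j}) · λ_{jg}`, `λ = 2` if `p_j < g` else `1`. -/
def pathRow (a : Fin n → Bool) (g : Fin (n + 1)) (σ : ZMod 3) : Fin (Fn n) → ZMod 3 :=
  fun j => σ * (sg (a (fpos j)) * (if 3 * j.val + 2 < g.val then 2 else 1))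

/-- the RESONANCE VALUE `rv_{gj}(a) = β_{g,3j+2} sg(x_{3j+2}(a)) + β_{g,3j+3} sg(x_{3j+3}(a))`:
the increment of the `g`-th test form under the free bit `j`. -/
def rv (β : Fin (n + 1) → Fin (n + 1) → ZMod 3) (a : Fin n → Bool) (g : Fin (n + 1)) (j : Fin (Fn n)) : ZMod 3 :=
  β g (xposA j) * sg (xOfU a (xposA j)) + β g (xposB j) * sg (xOfU a (xposB j))

/-- the TEST ROW `m · rv_g + σ · path_g`. -/
def testRow (β : Fin (n + 1) → Fin (n + 1) → ZMod 3) (a : Fin n → Bool) (g : Fin (n + 1)) (σ m : ZMod 3) :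
    Fin (Fn n) → ZMod 3 :=
  fun j => m * rv β a g j + pathRow a g σ j

/-- number of RESONANT pairs of the test row `(g, σ, m)`: its zero letters. -/
def Zcount (β : Fin (n + 1) → Fin (n + 1) → ZMod 3) (a : Fin n → Bool) (g : Fin (n + 1)) (σ m : ZMod 3) : ℕ :=
  (univ.filter fun j => testRow β a g σ m j = 0).card

/-- Weight plus zero-count of a test row is the number of free positions `Fn n`. -/
theorem wt_add_Zcount (β : Fin (n + 1) → Fin (n + 1) → ZMod 3) (a : Fin n → Bool) (g : Fin (n + 1)) (σ m : ZMod 3) :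
    wt (testRow β a g σ m) + Zcount β a g σ m = Fn n := by
  unfold wt Zcount
  have h := Finset.card_filter_add_card_filter_not (s := (univ : Finset (Fin (Fn n))))
    (fun j => testRow β a g σ m j ≠ 0)
  simp only [not_not, card_univ, Fintype.card_fin] at h
  exact h

/-- A path row with `σ ≠ 0` has full weight `Fn n`. -/
theorem wt_pathRow (a : Fin n → Bool) (g : Fin (n + 1)) {σ : ZMod 3} (hσ : σ ≠ 0) : wt (pathRow a g σ) = Fn n := by
  unfold wt pathRow
  rw [Finset.filter_true_of_mem, card_univ, Fintype.card_fin]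
  intro j _
  have h1 := sg_ne_zero (a (fpos j))
  have h3 : ∀ x y z : ZMod 3, x ≠ 0 → y ≠ 0 → (z = 1 ∨ z = 2) → x * (y * z) ≠ 0 := by decide
  exact h3 σ _ _ hσ h1 (by split_ifs <;> simp)

/-- changing one letter lowers the weight by at most one. -/
theorem wt_le_of_eq_off (A B : Fin (Fn n) → ZMod 3) (j : Fin (Fn n)) (h : ∀ i, i ≠ j → B i = A i) :
    wt A ≤ wt B + 1 := by
  unfold wt
  calc (univ.filter fun i => A i ≠ 0).card
      ≤ ((univ.filter fun i => B i ≠ 0) ∪ {j}).card := by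
        refine card_le_card fun i hi => ?_
        rw [mem_filter] at hi
        rw [mem_union, mem_filter, mem_singleton]
        by_cases hij : i = j
        · exact Or.inr hij
        · exact Or.inl ⟨mem_univ _, by rw [h i hij]; exact hi.2⟩
    _ ≤ (univ.filter fun i => B i ≠ 0).card + ({j} : Finset (Fin (Fn n))).card := card_union_le _ _
    _ = _ := by rw [card_singleton]

/-- adding a single letter `1` at `j` lowers the weight by at most one. -/
theorem wt_add_single_ge (A : Fin (Fn n) → ZMod 3) (j : Fin (Fn n)) :
    wt A ≤ wt (A + Pi.single j (1 : ZMod 3)) + 1 :=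
  wt_le_of_eq_off A _ j fun i hi => by rw [Pi.add_apply, Pi.single_eq_of_ne hi, add_zero]

/-! ### The explicit character family of a slice -/

/-- `ω^z` for `z ∈ ℤ/3`. -/
def ωz (z : ZMod 3) : F4 := ω ^ z.val

/-- the slice constants: walk label exponent `E_g(a) = n+2+g+e_g(a)` and test value `D_g(a) = ℓ_g(x(a)) − c_g`. -/
def Eg (a : Fin n → Bool) (g : Fin (n + 1)) : ZMod 3 := ((n + 2 + g.val + walkExp a g.val : ℕ) : ZMod 3)
/-- the test value `D_g(a) = ℓ_g(x(a)) − c_g` of bell `g` on the base point. -/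
def Dg (β : Fin (n + 1) → Fin (n + 1) → ZMod 3) (c : Fin (n + 1) → ZMod 3) (a : Fin n → Bool) (g : Fin (n + 1)) :
    ZMod 3 :=
  (∑ i : Fin (n + 1), if xOfU a i then β g i else 0) - c g

/-- `σ ∈ {1, 2}` coded by a Boolean. -/
def σv (σ : Bool) : ZMod 3 := if σ then 2 else 1

/-- `σv σ ∈ {1, 2}` is nonzero. -/
theorem σv_ne_zero (σ : Bool) : σv σ ≠ 0 := by cases σ <;> decide

/-- index of the family: bell `g`, Frobenius branch `σ`, and the kind — `inl 0` constant row,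
`inl 1`/`inl 2` test rows `m = 1, 2`, `inr (j, side, part)` the `tGuess` rows. -/
abbrev Ix (n : ℕ) : Type := Fin (n + 1) × Bool × (Fin 3 ⊕ (Fin (Fn n) × Bool × Bool))

/-- the target `x`-index of a `tGuess` side: `g` itself or `nxt g`. -/
def tgt (g : Fin (n + 1)) (side : Bool) : Fin (n + 1) := if side then nxt g else g

/-- the rows. -/
def rows (β : Fin (n + 1) → Fin (n + 1) → ZMod 3) (a : Fin n → Bool) : Ix n → Fin (Fn n) → ZMod 3
  | (g, σ, Sum.inl k) => if k = 0 then pathRow a g (σv σ) else testRow β a g (σv σ) ((k.val : ℕ) : ZMod 3)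
  | (g, σ, Sum.inr (j, _, part)) => pathRow a g (σv σ) + (if part then Pi.single j 1 else 0)

/-- the coefficients. -/
def coefs (β : Fin (n + 1) → Fin (n + 1) → ZMod 3) (c : Fin (n + 1) → ZMod 3) (a : Fin n → Bool) : Ix n → F4
  | (g, σ, Sum.inl k) =>
      if k = 0 then ωz (σv σ * Eg a g) * (1 + ιF (xOfU a g) + ιF (xOfU a (nxt g)))
      else ωz (((k.val : ℕ) : ZMod 3) * Dg β c a g + σv σ * Eg a g)
  | (g, σ, Sum.inr (j, side, _)) =>
      if (tgt g side = xposA j ∨ tgt g side = xposB j) then ω * ωz (σv σ * Eg a g) else 0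

/-! ### The stubs of the line (P2-34a (E1), (E2), (R)) and the assembly -/

/-- **(E) SLICE EXPANSION** — on every slice the win indicator IS the character family. -/
def SliceExpansion : Prop :=
  ∀ n ≥ 4, ∀ (β : Fin (n + 1) → Fin (n + 1) → ZMod 3) (c : Fin (n + 1) → ZMod 3) (a : Fin n → Bool)
    (v : Fin (Fn n) → Bool), ιF (Wn β c (U a v)) = ev univ (rows β a) (coefs β c a) v

/-- **(R) RESONANCE MGF** — `Σ_a 2^{Z_{gσm}(a)} ≤ 2ⁿ (3/2)^{Fn}`. -/
def ResonanceMGF : Prop :=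
  ∀ n, ∀ (β : Fin (n + 1) → Fin (n + 1) → ZMod 3) (g : Fin (n + 1)) (σ m : ZMod 3), σ ≠ 0 → m ≠ 0 →
    (∑ a : Fin n → Bool, (2 : ℝ) ^ Zcount β a g σ m) ≤ (2 : ℝ) ^ n * (3 / 2 : ℝ) ^ Fn n

/-- mass bookkeeping of the rows: constant rows weigh `Fn`, `tGuess` rows `≥ Fn − 1`, test rows `Fn − Z`. -/
theorem mass_rows_le (β : Fin (n + 1) → Fin (n + 1) → ZMod 3) (a : Fin n → Bool) :
    ∑ b : Ix n, 2 ^ (Fn n - wt (rows β a b))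
      ≤ 2 * (n + 1) * (1 + 8 * Fn n) +
        ∑ g : Fin (n + 1), ∑ σ : Bool, ∑ k : Fin 3,
          (if k = 0 then 0 else 2 ^ Zcount β a g (σv σ) ((k.val : ℕ) : ZMod 3)) := by
  have hsplit : ∑ b : Ix n, (2 : ℕ) ^ (Fn n - wt (rows β a b))
      = ∑ g : Fin (n + 1), ∑ σ : Bool, ((∑ k : Fin 3, 2 ^ (Fn n - wt (rows β a (g, σ, Sum.inl k))))
          + ∑ t : Fin (Fn n) × Bool × Bool, 2 ^ (Fn n - wt (rows β a (g, σ, Sum.inr t)))) := by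
    rw [Fintype.sum_prod_type]
    refine Fintype.sum_congr _ _ fun g => ?_
    rw [Fintype.sum_prod_type]
    refine Fintype.sum_congr _ _ fun σ => ?_
    rw [Fintype.sum_sum_type]
  rw [hsplit]
  have hinl : ∀ (g : Fin (n + 1)) (σ : Bool) (k : Fin 3), 2 ^ (Fn n - wt (rows β a (g, σ, Sum.inl k)))
      = (if k = 0 then 1 else 0) + (if k = 0 then 0 else 2 ^ Zcount β a g (σv σ) ((k.val : ℕ) : ZMod 3)) := by
    intro g σ k
    by_cases hk : k = 0
    · simp only [rows, hk, if_true]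
      rw [wt_pathRow a g (σv_ne_zero σ), Nat.sub_self, pow_zero]
      rfl
    · simp only [rows, hk, if_false, Nat.zero_add]
      have h := wt_add_Zcount β a g (σv σ) ((k.val : ℕ) : ZMod 3)
      rw [show Fn n - wt (testRow β a g (σv σ) ((k.val : ℕ) : ZMod 3)) = Zcount β a g (σv σ) ((k.val : ℕ) : ZMod 3)
        by omega]
  have hinr : ∀ (g : Fin (n + 1)) (σ : Bool) (t : Fin (Fn n) × Bool × Bool),
      2 ^ (Fn n - wt (rows β a (g, σ, Sum.inr t))) ≤ 2 := by
    rintro g σ ⟨j, side, part⟩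
    have hp := wt_pathRow a g (σv_ne_zero σ)
    cases part
    · simp only [rows, Bool.false_eq_true, if_false, add_zero]
      rw [hp, Nat.sub_self, pow_zero]; norm_num
    · simp only [rows, if_true]
      have h1 := wt_add_single_ge (pathRow a g (σv σ)) j
      rw [hp] at h1
      calc 2 ^ (Fn n - wt (pathRow a g (σv σ) + Pi.single j (1 : ZMod 3)))
          ≤ 2 ^ 1 := Nat.pow_le_pow_right (by norm_num) (by omega)
        _ = 2 := by norm_num
  have hblock : ∀ (g : Fin (n + 1)) (σ : Bool),
      ((∑ k : Fin 3, 2 ^ (Fn n - wt (rows β a (g, σ, Sum.inl k))))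
        + ∑ t : Fin (Fn n) × Bool × Bool, 2 ^ (Fn n - wt (rows β a (g, σ, Sum.inr t))))
      ≤ (1 + 8 * Fn n) + ∑ k : Fin 3, (if k = 0 then 0 else 2 ^ Zcount β a g (σv σ) ((k.val : ℕ) : ZMod 3)) := by
    intro g σ
    have h1 : ∑ k : Fin 3, 2 ^ (Fn n - wt (rows β a (g, σ, Sum.inl k)))
        = 1 + ∑ k : Fin 3, (if k = 0 then 0 else 2 ^ Zcount β a g (σv σ) ((k.val : ℕ) : ZMod 3)) := by
      rw [Fintype.sum_congr _ _ (hinl g σ), sum_add_distrib]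
      norm_num [Fin.sum_univ_three]
    have h2 : ∑ t : Fin (Fn n) × Bool × Bool, 2 ^ (Fn n - wt (rows β a (g, σ, Sum.inr t))) ≤ 8 * Fn n := by
      calc ∑ t : Fin (Fn n) × Bool × Bool, 2 ^ (Fn n - wt (rows β a (g, σ, Sum.inr t)))
          ≤ ∑ _t : Fin (Fn n) × Bool × Bool, 2 := sum_le_sum fun t _ => hinr g σ t
        _ = 8 * Fn n := by
          rw [sum_const, card_univ, smul_eq_mul, Fintype.card_prod, Fintype.card_prod, Fintype.card_bool,
            Fintype.card_fin]
          ring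
    rw [h1]
    omega
  calc ∑ g : Fin (n + 1), ∑ σ : Bool, ((∑ k : Fin 3, 2 ^ (Fn n - wt (rows β a (g, σ, Sum.inl k))))
          + ∑ t : Fin (Fn n) × Bool × Bool, 2 ^ (Fn n - wt (rows β a (g, σ, Sum.inr t))))
      ≤ ∑ g : Fin (n + 1), ∑ σ : Bool,
          ((1 + 8 * Fn n) + ∑ k : Fin 3, (if k = 0 then 0 else 2 ^ Zcount β a g (σv σ) ((k.val : ℕ) : ZMod 3))) :=
        sum_le_sum fun g _ => sum_le_sum fun σ _ => hblock g σ
    _ = _ := by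
        simp only [sum_add_distrib, sum_const, card_univ, Fintype.card_bool, Fintype.card_fin, smul_eq_mul]
        ring

/-- Numerics: `16(3k+4)3^k ≤ 4^k` for `k ≥ 30`. -/
theorem growth1 (k : ℕ) (hk : 30 ≤ k) : 16 * (3 * k + 4) * 3 ^ k ≤ 4 ^ k := by
  induction k, hk using Nat.le_induction with
  | base => norm_num
  | succ k hk ih =>
    calc 16 * (3 * (k + 1) + 4) * 3 ^ (k + 1) = (3 * (3 * k + 7)) * (16 * 3 ^ k) := by ring
      _ ≤ (4 * (3 * k + 4)) * (16 * 3 ^ k) := Nat.mul_le_mul_right _ (by omega)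
      _ = 4 * (16 * (3 * k + 4) * 3 ^ k) := by ring
      _ ≤ 4 * 4 ^ k := Nat.mul_le_mul_left 4 ih
      _ = 4 ^ (k + 1) := by ring

/-- Numerics: `4(3k+4)(1+8k) ≤ 2^k` for `k ≥ 30`. -/
theorem growth2 (k : ℕ) (hk : 30 ≤ k) : 4 * (3 * k + 4) * (1 + 8 * k) ≤ 2 ^ k := by
  induction k, hk using Nat.le_induction with
  | base => norm_num
  | succ k hk ih =>
    have hpoly : 4 * (3 * (k + 1) + 4) * (1 + 8 * (k + 1)) ≤ 2 * (4 * (3 * k + 4) * (1 + 8 * k)) := by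
      nlinarith
    calc 4 * (3 * (k + 1) + 4) * (1 + 8 * (k + 1)) ≤ 2 * (4 * (3 * k + 4) * (1 + 8 * k)) := hpoly
      _ ≤ 2 * 2 ^ k := Nat.mul_le_mul_left 2 ih
      _ = 2 ^ (k + 1) := by ring

/-- Cardinality of the index type: `|Ix n| = (n+1)(6 + 8·Fn n)`. -/
theorem card_Ix (n : ℕ) : Fintype.card (Ix n) = (n + 1) * (6 + 8 * Fn n) := by
  simp only [Ix, Fintype.card_prod, Fintype.card_sum, Fintype.card_bool, Fintype.card_fin]
  ring

end Slicing

end Summit.QuantumAdvantage.AdviceFreeQNC0.AffBells37
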